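import Summits.QuantumFields.YangMills.Theorems.FluctuationComparisonRegPrIntLS2BetaChartContBlindCharts
import Summits.QuantumFields.YangMills.Theorems.FluctuationComparisonRegPrIntLS2BetaChartContFibredChart
import HarnessLib

/-!
# CHART∞ · IV-c (LINE g18-1 `semiclassical_s2beta`, organ S2β, LAPLACE row): the fibred chart, pivot-blind, and the TRANSFER of its continuity to the
# `pivotAct`-invariant closed chain set

R3 = Balaban's UV-stability programme on the finite 3-torus, gauge group `SU(N)` (generic `(P, N)` here) — NOT d = 4, NOT infinite volume, NOT a mass gap,
NOT Clay; the Yang–Mills gap is NOT proved by anything in this file.  Helper toward crux `stmt-QuantumFields-20520` (`FluctuationComparisonRegPrIntL`),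
LINE g18-1, LAPLACE row, letter CHART∞ (IV).

★★★`exists_fibredChart_iter_cont_blind` = Part III's ✓`exists_fibredChart_iter_cont` (sixteen conjuncts VERBATIM, same chart `Φ`, same Jacobian `Jac`) built on
IV-b's ✓`exists_chainCharts_cont_blind`, with four more conjuncts: (17) `T c` is blind to resampling the pivots; (18) so is `Φ (V, ·)` on `{z | ∀ c, V c ∈ T c z}`;
(19) so is `Jac (V, ·)` (everywhere); and (20) ★★★ THE TRANSFER: for every `(V, z₀)` with `∀ c, V c ∈ T c z₀` and STRICT small history of the CHARTED field
`Φ (V, z₀)` (not of `z₀` — a condition blind to the pivot entries of `z₀`, implied by `Φ (V, z₀) ∈ histGood` with thresholds `< α`), `Φ` and `Jac` are continuous at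
`(V, z₀)` WITHIN the pivot-blind window graph `{(V, z) | ∀ c, V c ∈ T c z}` — proved by carrying conjunct (16) at the charted point `z₁ = Φ (V, z₀)` back along the
pivot right-translation `z ↦ z[βₙc ↦ z(βₙc) · z₀(βₙc)⁻¹ · z₁(βₙc)]` (a homeomorphism preserving the window graph, `Φ` and `Jac`).  Consequently, for FIXED `V`,
`z ↦ Φ (V, z)` and `z ↦ Jac (V, z)` are `ContinuousOn` the `pivotAct`-INVARIANT set `XcV = {z | (∀ c, V c ∈ T c z) ∧ strict small history of Φ (V, z)}` — the
carrier the LAPLACE door (`…S2BetaLaplaceLimitOn` ∕ `…S2BetaLaplaceInst`) integrates over.  [cite: Balaban1987RG1, (0.4) p.253, (2.4) p.266 and (2.10) p.267]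
-/

noncomputable section

open MeasureTheory Filter Topology Set
open scoped ENNReal NNReal
open Literature.MathematicalPhysics.QuantumFieldTheory.Balaban1983to89
open Literature.MathematicalPhysics.QuantumFieldTheory.Balaban1983to89.T4Continuum

namespace Summit.QuantumFields.YangMills.Theorems.FluctuationComparisonRegPrIntLS2BetaChartContBlindFibredChart

open Summit.QuantumFields.YangMills.Theorems.FluctuationComparisonRegPrIntLWregChain
open Summit.QuantumFields.YangMills.Theorems.FluctuationComparisonRegPrIntLWregFibredChart
open Summit.QuantumFields.YangMills.Theorems.FluctuationComparisonRegPrIntLS2BetaChartContBlindCharts (exists_chainCharts_cont_blind)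
open Summit.QuantumFields.YangMills.Theorems.FluctuationComparisonRegPrIntLS2BetaChartContFibredChart (isOpen_loopSmallSet_lt loopSmallSet_mem_nhds_of_lt)
open Function
open Literature.MathematicalPhysics.QuantumFieldTheory.Balaban1983to89.BlockAveraging (Idx avgFun measurable_avgFun loopHol)
open Literature.MathematicalPhysics.QuantumFieldTheory.Balaban1983to89.BlockAveragingHaarAC (centralBond centralBond_injective isLocal_avgFun pre post)
open Literature.MathematicalPhysics.QuantumFieldTheory.Balaban1983to89.BlockAveragingEMLHaarAC (fibreFamily offCard)
open Literature.MathematicalPhysics.QuantumFieldTheory.Balaban1983to89.ExpMeanLog (expMeanLogSU deltaSU deltaSU_pos measurable_expMeanLogSU_E)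
open Literature.MathematicalPhysics.QuantumFieldTheory.Balaban1983to89.Node00 (SU)

variable {P : Params} {N : ℕ} [NeZero N]

/-- ★★★ **CHART-ALG III + CHART-REG + CHART∞, PIVOT-BLIND, WITH THE TRANSFER** (= ✓`exists_fibredChart_iter_cont` verbatim + conjuncts (17)–(20) of the module
docstring: blindness of `T`, `Φ`, `Jac` to resampling the pivots and continuity within the pivot-blind window graph at every point whose CHARTED field has strict
small history).  ORIGINAL DOCSTRING — the fibred chart of the iterated averaging with its image windows (✓`exists_fibredChart_iter_reg` verbatim) AND
joint continuity of the chart and of its Jacobian on the guarded closed chain set `{(V, z) | small loop history of z below level n ∧ ∀ c, V c ∈ T c z}`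
(Part II ✓`exists_chainCharts_cont` coordinate by coordinate through ✓`extend`; the Jacobian is the finite product of the `jd c z (V c)` there).
[cite: Balaban1987RG1, (0.4) p.253, (2.4) p.266 and (2.10) p.267] -/
theorem exists_fibredChart_iter_cont_blind {α : ℝ} (hα0 : 0 ≤ α) (hα24 : α ≤ 1 / 24) (hα64 : 64 * α ≤ deltaSU (Fin N))
    (hαL : 157 * α < ((P.L : ℝ) ^ (P.d - 1))⁻¹)
    (hgap : ∀ j (c : PBond P (j + 1)), (offCard c : ℝ) / (Fintype.card (Idx P) : ℝ) + 150 * α < 1)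
    {j₀ : ℝ≥0} (hvol : j₀ = 0 ∨ ChainVol P N α j₀) {n : ℕ} (hn : n ≤ P.m + P.K) :
    ∃ (Φ : GaugeField P n (SU N) × GaugeField P 0 (SU N) → GaugeField P 0 (SU N)) (Jac : GaugeField P n (SU N) × GaugeField P 0 (SU N) → ℝ≥0)
      (T : PBond P n → GaugeField P 0 (SU N) → Set (SU N)),
      Measurable Φ ∧ Measurable Jac ∧
      (∀ V z, Jac (V, z) ≠ 0 → Averaging.iter (fun i => BlockAveraging.blockAvg (P := P) (j := i) (expMeanLogSU (n := Fin N))) n (Φ (V, z)) = V) ∧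
      (∀ U₀ : Set (GaugeField P n (SU N)), MeasurableSet U₀ →
        (fieldMeasure P 0 (SU N)).restrict
            (Averaging.iter (fun i => BlockAveraging.blockAvg (P := P) (j := i) (expMeanLogSU (n := Fin N))) n ⁻¹' U₀ ∩
              {U | ∀ c, U (iterCentralBond n c) ∈ chainWindow α n U c}) =
          ((((fieldMeasure P n (SU N)).restrict U₀).prod (fieldMeasure P 0 (SU N))).withDensity fun p => (Jac p : ℝ≥0∞)).map Φ) ∧
      (∀ c z, IsClosed (T c z)) ∧
      (∀ V z, Jac (V, z) ≠ 0 ↔ ∀ c, V c ∈ T c z) ∧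
      (∀ V₀ z, (∀ c, V₀ c ∈ interior (T c z)) → ContinuousAt (fun V => Φ (V, z)) V₀ ∧ ContinuousAt (fun V => Jac (V, z)) V₀) ∧
      (∀ V₀ z, (∃ c, V₀ c ∉ closure (T c z)) → ∀ᶠ V in 𝓝 V₀, Jac (V, z) = 0) ∧
      (∀ c z, T c z = chainMap (expMeanLogSU (n := Fin N)) n z c '' chainWindow α n z c) ∧
      (∀ V z, (∀ c, V c ∈ T c z) → (∀ b, (∀ c, iterCentralBond n c ≠ b) → Φ (V, z) b = z b) ∧
        ∀ c, Φ (V, z) (iterCentralBond n c) ∈ chainWindow α n (Φ (V, z)) c) ∧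
      (∀ p, j₀ ^ (n * Fintype.card (PBond P n)) * Jac p ≤ 1) ∧
      (∀ V z (g : PBond P n → SU N), (∀ c, g c ∈ chainWindow α n z c) →
        (∀ c, V c = Averaging.iter (fun i => BlockAveraging.blockAvg (P := P) (j := i) (expMeanLogSU (n := Fin N))) n
          (extend (iterCentralBond n) g z) c) →
        Jac (V, z) ≠ 0 ∧ Φ (V, z) = extend (iterCentralBond n) g z) ∧
      ContinuousOn Φ {p : GaugeField P n (SU N) × GaugeField P 0 (SU N) |
        (∀ k, k < n → ∀ (c' : PBond P (k + 1)) (i : Idx P),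
          dist1 (loopHol (Averaging.iter (fun i => BlockAveraging.blockAvg (P := P) (j := i) (expMeanLogSU (n := Fin N))) k p.2) c' i) ≤ α) ∧
        ∀ c, p.1 c ∈ T c p.2} ∧
      ContinuousOn Jac {p : GaugeField P n (SU N) × GaugeField P 0 (SU N) |
        (∀ k, k < n → ∀ (c' : PBond P (k + 1)) (i : Idx P),
          dist1 (loopHol (Averaging.iter (fun i => BlockAveraging.blockAvg (P := P) (j := i) (expMeanLogSU (n := Fin N))) k p.2) c' i) ≤ α) ∧
        ∀ c, p.1 c ∈ T c p.2} ∧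
      (∀ (V : GaugeField P n (SU N)) (z₀ : GaugeField P 0 (SU N)),
        (∀ k, k < n → ∀ (c' : PBond P (k + 1)) (i : Idx P),
          dist1 (loopHol (Averaging.iter (fun i => BlockAveraging.blockAvg (P := P) (j := i) (expMeanLogSU (n := Fin N))) k z₀) c' i) < α) →
        (∀ c, V c ∈ T c z₀) →
        ContinuousWithinAt Φ {p : GaugeField P n (SU N) × GaugeField P 0 (SU N) | ∀ c, p.1 c ∈ T c p.2} (V, z₀) ∧
        ContinuousWithinAt Jac {p : GaugeField P n (SU N) × GaugeField P 0 (SU N) | ∀ c, p.1 c ∈ T c p.2} (V, z₀)) ∧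
      (∀ c z (g : PBond P n → SU N), T c (extend (iterCentralBond n) g z) = T c z) ∧
      (∀ V z (g : PBond P n → SU N), (∀ c, V c ∈ T c z) → Φ (V, extend (iterCentralBond n) g z) = Φ (V, z)) ∧
      (∀ V z (g : PBond P n → SU N), Jac (V, extend (iterCentralBond n) g z) = Jac (V, z)) ∧
      (∀ (V : GaugeField P n (SU N)) (z₀ : GaugeField P 0 (SU N)), (∀ c, V c ∈ T c z₀) →
        (∀ k, k < n → ∀ (c' : PBond P (k + 1)) (i : Idx P),
          dist1 (loopHol (Averaging.iter (fun i => BlockAveraging.blockAvg (P := P) (j := i) (expMeanLogSU (n := Fin N))) k (Φ (V, z₀))) c' i) < α) →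
        ContinuousWithinAt Φ {p : GaugeField P n (SU N) × GaugeField P 0 (SU N) | ∀ c, p.1 c ∈ T c p.2} (V, z₀) ∧
        ContinuousWithinAt Jac {p : GaugeField P n (SU N) × GaugeField P 0 (SU N) | ∀ c, p.1 c ∈ T c p.2} (V, z₀)) := by
  have hαδ : α < deltaSU (Fin N) := by nlinarith [deltaSU_pos (n := Fin N)]
  obtain ⟨T, ϑ, jd, hTm, hθm, hjm, hright, hlaw, hTeq, hleft, hmemW, hTc, hθc, hjc, hj0, hjlb, hθg, hjdg, hTbl, hθbl, hjdbl⟩ :=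
    exists_chainCharts_cont_blind (N := N) (P := P) hα0 hα24 hα64 hαL hgap hvol hn
  have hA := isLocal_iter_blockAvg (P := P) (expMeanLogSU (n := Fin N)) hn
  have hβ := iterCentralBond_injective (P := P) (n := n) hn
  have hAm : Measurable (Averaging.iter (fun i => BlockAveraging.blockAvg (P := P) (j := i) (expMeanLogSU (n := Fin N))) n) :=
    T4Continuum.measurable_iter _ (fun j => by rw [BlockAveraging.blockAvg_avg]; exact measurable_avgFun _ measurable_expMeanLogSU_E) n
  have hright' : ∀ c U, ∀ v ∈ T c U,
      Averaging.iter (fun i => BlockAveraging.blockAvg (P := P) (j := i) (expMeanLogSU (n := Fin N))) n (update U (iterCentralBond n c) (ϑ c U v)) c = v :=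
    fun c U v hv => hright c U v hv
  refine ⟨fun p => extend (iterCentralBond n) (fun c => ϑ c p.2 (p.1 c)) p.2,
    fun p => {p : GaugeField P n (SU N) × GaugeField P 0 (SU N) | ∀ c, p.1 c ∈ T c p.2}.indicator (fun p => ∏ c, jd c p.2 (p.1 c)) p, T,
    T4TriangularFibredChart.measurable_triChart ϑ hβ hθm, T4TriangularFibredChart.measurable_triJacobian T jd hTm hjm,
    fun V z hJ => T4TriangularFibredChart.apply_triChart_eq_of_jacobian_ne_zero T ϑ jd hA hβ hright' hJ, fun U₀ hU₀ => ?_, hTc,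
    fun V z => ?_, fun V₀ z hint => ?_, fun V₀ z hout => ?_, hTeq, fun V z hV => ?charted, fun p => ?bdd, fun V z g hg hVg => ?recog, ?contAll⟩
  case contAll =>
    -- blindness of the chart and of the Jacobian to resampling the pivots
    have hΦbl : ∀ (V : GaugeField P n (SU N)) (z : GaugeField P 0 (SU N)) (g : PBond P n → SU N), (∀ c, V c ∈ T c z) →
        extend (iterCentralBond n) (fun c => ϑ c (extend (iterCentralBond n) g z) (V c)) (extend (iterCentralBond n) g z) =
          extend (iterCentralBond n) (fun c => ϑ c z (V c)) z := fun V z g hV => by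
      have hfun : (fun c => ϑ c (extend (iterCentralBond n) g z) (V c)) = fun c => ϑ c z (V c) := funext fun c => hθbl c z g (V c) (hV c)
      rw [hfun]
      funext b
      by_cases hb : ∃ c, iterCentralBond n c = b
      · obtain ⟨c, rfl⟩ := hb
        simp only [hβ.extend_apply]
      · simp only [extend_apply' _ _ _ hb]
    have hJbl : ∀ (V : GaugeField P n (SU N)) (z : GaugeField P 0 (SU N)) (g : PBond P n → SU N),
        {p : GaugeField P n (SU N) × GaugeField P 0 (SU N) | ∀ c, p.1 c ∈ T c p.2}.indicator (fun p => ∏ c, jd c p.2 (p.1 c))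
            (V, extend (iterCentralBond n) g z) =
          {p : GaugeField P n (SU N) × GaugeField P 0 (SU N) | ∀ c, p.1 c ∈ T c p.2}.indicator (fun p => ∏ c, jd c p.2 (p.1 c)) (V, z) := fun V z g => by
      by_cases hV : ∀ c, V c ∈ T c z
      · have h1 : ((V, extend (iterCentralBond n) g z) : GaugeField P n (SU N) × GaugeField P 0 (SU N)) ∈
            {p : GaugeField P n (SU N) × GaugeField P 0 (SU N) | ∀ c, p.1 c ∈ T c p.2} := fun c => by
          show V c ∈ T c (extend (iterCentralBond n) g z)
          rw [hTbl c z g]; exact hV c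
        have h2 : ((V, z) : GaugeField P n (SU N) × GaugeField P 0 (SU N)) ∈
            {p : GaugeField P n (SU N) × GaugeField P 0 (SU N) | ∀ c, p.1 c ∈ T c p.2} := hV
        rw [Set.indicator_of_mem h1, Set.indicator_of_mem h2]
        exact Finset.prod_congr rfl fun c _ => hjdbl c z g (V c) (hV c)
      · have h1 : ((V, extend (iterCentralBond n) g z) : GaugeField P n (SU N) × GaugeField P 0 (SU N)) ∉
            {p : GaugeField P n (SU N) × GaugeField P 0 (SU N) | ∀ c, p.1 c ∈ T c p.2} := fun h => hV fun c => by
          have hc : V c ∈ T c (extend (iterCentralBond n) g z) := h c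
          rwa [hTbl c z g] at hc
        have h2 : ((V, z) : GaugeField P n (SU N) × GaugeField P 0 (SU N)) ∉
            {p : GaugeField P n (SU N) × GaugeField P 0 (SU N) | ∀ c, p.1 c ∈ T c p.2} := hV
        rw [Set.indicator_of_notMem h1, Set.indicator_of_notMem h2]
    have hΦc : ContinuousOn (fun p : GaugeField P n (SU N) × GaugeField P 0 (SU N) => extend (iterCentralBond n) (fun c => ϑ c p.2 (p.1 c)) p.2)
        {p : GaugeField P n (SU N) × GaugeField P 0 (SU N) |
          (∀ k, k < n → ∀ (c' : PBond P (k + 1)) (i : Idx P),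
            dist1 (loopHol (Averaging.iter (fun i => BlockAveraging.blockAvg (P := P) (j := i) (expMeanLogSU (n := Fin N))) k p.2) c' i) ≤ α) ∧
          ∀ c, p.1 c ∈ T c p.2} := continuousOn_pi.2 fun b => by
      by_cases hb : ∃ c, iterCentralBond n c = b
      · obtain ⟨c, rfl⟩ := hb
        have h1 : (fun p : GaugeField P n (SU N) × GaugeField P 0 (SU N) => extend (iterCentralBond n) (fun c => ϑ c p.2 (p.1 c)) p.2 (iterCentralBond n c)) =
            fun p => ϑ c p.2 (p.1 c) := funext fun p => hβ.extend_apply _ _ _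
        rw [h1]
        have hι : Continuous fun p : GaugeField P n (SU N) × GaugeField P 0 (SU N) => ((p.2, p.1 c) : GaugeField P 0 (SU N) × SU N) :=
          continuous_snd.prodMk ((continuous_apply c).comp continuous_fst)
        exact (hθg c).comp hι.continuousOn fun p hp => ⟨hp.1, hp.2 c⟩
      · have h1 : (fun p : GaugeField P n (SU N) × GaugeField P 0 (SU N) => extend (iterCentralBond n) (fun c => ϑ c p.2 (p.1 c)) p.2 b) =
            fun p => p.2 b := funext fun p => extend_apply' _ _ _ hb
        rw [h1]
        exact ((continuous_apply b).comp continuous_snd).continuousOn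
    have hJc : ContinuousOn (fun p : GaugeField P n (SU N) × GaugeField P 0 (SU N) =>
        {p : GaugeField P n (SU N) × GaugeField P 0 (SU N) | ∀ c, p.1 c ∈ T c p.2}.indicator (fun p => ∏ c, jd c p.2 (p.1 c)) p)
        {p : GaugeField P n (SU N) × GaugeField P 0 (SU N) |
          (∀ k, k < n → ∀ (c' : PBond P (k + 1)) (i : Idx P),
            dist1 (loopHol (Averaging.iter (fun i => BlockAveraging.blockAvg (P := P) (j := i) (expMeanLogSU (n := Fin N))) k p.2) c' i) ≤ α) ∧
          ∀ c, p.1 c ∈ T c p.2} := by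
      have hprod : ContinuousOn (fun p : GaugeField P n (SU N) × GaugeField P 0 (SU N) => ∏ c, jd c p.2 (p.1 c))
          {p : GaugeField P n (SU N) × GaugeField P 0 (SU N) |
            (∀ k, k < n → ∀ (c' : PBond P (k + 1)) (i : Idx P),
              dist1 (loopHol (Averaging.iter (fun i => BlockAveraging.blockAvg (P := P) (j := i) (expMeanLogSU (n := Fin N))) k p.2) c' i) ≤ α) ∧
            ∀ c, p.1 c ∈ T c p.2} :=
        continuousOn_finsetProd _ fun c _ => by
          have hι : Continuous fun p : GaugeField P n (SU N) × GaugeField P 0 (SU N) => ((p.2, p.1 c) : GaugeField P 0 (SU N) × SU N) :=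
            continuous_snd.prodMk ((continuous_apply c).comp continuous_fst)
          exact (hjdg c).comp hι.continuousOn fun p hp => ⟨hp.1, hp.2 c⟩
      refine hprod.congr fun p hp => ?_
      have hps : p ∈ {p : GaugeField P n (SU N) × GaugeField P 0 (SU N) | ∀ c, p.1 c ∈ T c p.2} := hp.2
      exact Set.indicator_of_mem hps (fun p : GaugeField P n (SU N) × GaugeField P 0 (SU N) => ∏ c, jd c p.2 (p.1 c))
    have hstrict : ∀ (V : GaugeField P n (SU N)) (z₀ : GaugeField P 0 (SU N)),
        (∀ k, k < n → ∀ (c' : PBond P (k + 1)) (i : Idx P),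
          dist1 (loopHol (Averaging.iter (fun i => BlockAveraging.blockAvg (P := P) (j := i) (expMeanLogSU (n := Fin N))) k z₀) c' i) < α) →
        (∀ c, V c ∈ T c z₀) →
        ContinuousWithinAt (fun p : GaugeField P n (SU N) × GaugeField P 0 (SU N) => extend (iterCentralBond n) (fun c => ϑ c p.2 (p.1 c)) p.2)
            {p : GaugeField P n (SU N) × GaugeField P 0 (SU N) | ∀ c, p.1 c ∈ T c p.2} (V, z₀) ∧
          ContinuousWithinAt (fun p : GaugeField P n (SU N) × GaugeField P 0 (SU N) =>
              {p : GaugeField P n (SU N) × GaugeField P 0 (SU N) | ∀ c, p.1 c ∈ T c p.2}.indicator (fun p => ∏ c, jd c p.2 (p.1 c)) p)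
            {p : GaugeField P n (SU N) × GaugeField P 0 (SU N) | ∀ c, p.1 c ∈ T c p.2} (V, z₀) := by
      intro V z₀ hz₀ hV
      have hmem : (V, z₀) ∈ {p : GaugeField P n (SU N) × GaugeField P 0 (SU N) |
          (∀ k, k < n → ∀ (c' : PBond P (k + 1)) (i : Idx P),
            dist1 (loopHol (Averaging.iter (fun i => BlockAveraging.blockAvg (P := P) (j := i) (expMeanLogSU (n := Fin N))) k p.2) c' i) ≤ α) ∧
          ∀ c, p.1 c ∈ T c p.2} := ⟨fun k hk c' i => (hz₀ k hk c' i).le, hV⟩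
      have hnhds : {p : GaugeField P n (SU N) × GaugeField P 0 (SU N) |
          (∀ k, k < n → ∀ (c' : PBond P (k + 1)) (i : Idx P),
            dist1 (loopHol (Averaging.iter (fun i => BlockAveraging.blockAvg (P := P) (j := i) (expMeanLogSU (n := Fin N))) k p.2) c' i) ≤ α) ∧
          ∀ c, p.1 c ∈ T c p.2} ∈ 𝓝[{p : GaugeField P n (SU N) × GaugeField P 0 (SU N) | ∀ c, p.1 c ∈ T c p.2}] (V, z₀) := by
        have h1 := continuous_snd.continuousAt.preimage_mem_nhds
          (loopSmallSet_mem_nhds_of_lt (P := P) (N := N) hαδ n hz₀ :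
            _ ∈ 𝓝 ((V, z₀) : GaugeField P n (SU N) × GaugeField P 0 (SU N)).2)
        filter_upwards [mem_nhdsWithin_of_mem_nhds h1, self_mem_nhdsWithin] with p hp hq
        exact ⟨hp, hq⟩
      exact ⟨(hΦc _ hmem).mono_of_mem_nhdsWithin hnhds, (hJc _ hmem).mono_of_mem_nhdsWithin hnhds⟩
    refine ⟨hΦc, hJc, hstrict, hTbl, fun V z g hV => hΦbl V z g hV, hJbl, fun V z₀ hV hz₁ => ?_⟩
    -- ★★★ TRANSFER along the pivot right-translation `τ p := (p.1, p.2[βₙc ↦ p.2 (βₙc) · k c])`, `k c := z₀(βₙc)⁻¹ · ϑ c z₀ (V c)`, taking `z₀` to `z₁ := Φ (V, z₀)`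
    have hT₁ : ∀ c, T c (extend (iterCentralBond n) (fun c => ϑ c z₀ (V c)) z₀) = T c z₀ := fun c => hTbl c z₀ _
    have hV₁ : ∀ c, V c ∈ T c (extend (iterCentralBond n) (fun c => ϑ c z₀ (V c)) z₀) := fun c => by rw [hT₁ c]; exact hV c
    have h₁ := hstrict V (extend (iterCentralBond n) (fun c => ϑ c z₀ (V c)) z₀) hz₁ hV₁
    have hτc : Continuous fun p : GaugeField P n (SU N) × GaugeField P 0 (SU N) =>
        ((p.1, extend (iterCentralBond n) (fun c => p.2 (iterCentralBond n c) * ((z₀ (iterCentralBond n c))⁻¹ * ϑ c z₀ (V c))) p.2) :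
          GaugeField P n (SU N) × GaugeField P 0 (SU N)) := by
      refine continuous_fst.prodMk (continuous_pi fun b => ?_)
      by_cases hb : ∃ c, iterCentralBond n c = b
      · obtain ⟨c, rfl⟩ := hb
        have h1 : (fun p : GaugeField P n (SU N) × GaugeField P 0 (SU N) =>
            extend (iterCentralBond n) (fun c => p.2 (iterCentralBond n c) * ((z₀ (iterCentralBond n c))⁻¹ * ϑ c z₀ (V c))) p.2 (iterCentralBond n c)) =
            fun p => p.2 (iterCentralBond n c) * ((z₀ (iterCentralBond n c))⁻¹ * ϑ c z₀ (V c)) := funext fun p => hβ.extend_apply _ _ _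
        rw [h1]
        exact ((continuous_apply _).comp continuous_snd).mul continuous_const
      · have h1 : (fun p : GaugeField P n (SU N) × GaugeField P 0 (SU N) =>
            extend (iterCentralBond n) (fun c => p.2 (iterCentralBond n c) * ((z₀ (iterCentralBond n c))⁻¹ * ϑ c z₀ (V c))) p.2 b) = fun p => p.2 b :=
          funext fun p => extend_apply' _ _ _ hb
        rw [h1]
        exact (continuous_apply b).comp continuous_snd
    have hτ₀ : ((V, extend (iterCentralBond n) (fun c => z₀ (iterCentralBond n c) * ((z₀ (iterCentralBond n c))⁻¹ * ϑ c z₀ (V c))) z₀) :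
          GaugeField P n (SU N) × GaugeField P 0 (SU N)) = (V, extend (iterCentralBond n) (fun c => ϑ c z₀ (V c)) z₀) := by
      have hfun : (fun c => z₀ (iterCentralBond n c) * ((z₀ (iterCentralBond n c))⁻¹ * ϑ c z₀ (V c))) = fun c => ϑ c z₀ (V c) :=
        funext fun c => mul_inv_cancel_left _ _
      exact congrArg (fun g : PBond P n → SU N => ((V, extend (iterCentralBond n) g z₀) : GaugeField P n (SU N) × GaugeField P 0 (SU N))) hfun
    have hτQ : MapsTo (fun p : GaugeField P n (SU N) × GaugeField P 0 (SU N) =>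
        ((p.1, extend (iterCentralBond n) (fun c => p.2 (iterCentralBond n c) * ((z₀ (iterCentralBond n c))⁻¹ * ϑ c z₀ (V c))) p.2) :
          GaugeField P n (SU N) × GaugeField P 0 (SU N)))
        {p : GaugeField P n (SU N) × GaugeField P 0 (SU N) | ∀ c, p.1 c ∈ T c p.2}
        {p : GaugeField P n (SU N) × GaugeField P 0 (SU N) | ∀ c, p.1 c ∈ T c p.2} := fun p hp c => by
      show p.1 c ∈ T c (extend (iterCentralBond n) (fun c => p.2 (iterCentralBond n c) * ((z₀ (iterCentralBond n c))⁻¹ * ϑ c z₀ (V c))) p.2)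
      rw [hTbl c p.2]; exact hp c
    refine ⟨?_, ?_⟩
    · have h₁' : ContinuousWithinAt (fun p : GaugeField P n (SU N) × GaugeField P 0 (SU N) => extend (iterCentralBond n) (fun c => ϑ c p.2 (p.1 c)) p.2)
          {p : GaugeField P n (SU N) × GaugeField P 0 (SU N) | ∀ c, p.1 c ∈ T c p.2}
          ((V, extend (iterCentralBond n) (fun c => z₀ (iterCentralBond n c) * ((z₀ (iterCentralBond n c))⁻¹ * ϑ c z₀ (V c))) z₀) :
            GaugeField P n (SU N) × GaugeField P 0 (SU N)) := by
        rw [hτ₀]; exact h₁.1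
      have hc := ContinuousWithinAt.comp (x := ((V, z₀) : GaugeField P n (SU N) × GaugeField P 0 (SU N)))
        (f := fun p : GaugeField P n (SU N) × GaugeField P 0 (SU N) =>
          ((p.1, extend (iterCentralBond n) (fun c => p.2 (iterCentralBond n c) * ((z₀ (iterCentralBond n c))⁻¹ * ϑ c z₀ (V c))) p.2) :
            GaugeField P n (SU N) × GaugeField P 0 (SU N)))
        h₁' hτc.continuousWithinAt hτQ
      exact hc.congr (fun p hp => (hΦbl p.1 p.2 (fun c => p.2 (iterCentralBond n c) * ((z₀ (iterCentralBond n c))⁻¹ * ϑ c z₀ (V c))) hp).symm) (hΦbl V z₀ (fun c => z₀ (iterCentralBond n c) * ((z₀ (iterCentralBond n c))⁻¹ * ϑ c z₀ (V c))) hV).symm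
    · have h₁' : ContinuousWithinAt (fun p : GaugeField P n (SU N) × GaugeField P 0 (SU N) =>
          {p : GaugeField P n (SU N) × GaugeField P 0 (SU N) | ∀ c, p.1 c ∈ T c p.2}.indicator (fun p => ∏ c, jd c p.2 (p.1 c)) p)
          {p : GaugeField P n (SU N) × GaugeField P 0 (SU N) | ∀ c, p.1 c ∈ T c p.2}
          ((V, extend (iterCentralBond n) (fun c => z₀ (iterCentralBond n c) * ((z₀ (iterCentralBond n c))⁻¹ * ϑ c z₀ (V c))) z₀) :
            GaugeField P n (SU N) × GaugeField P 0 (SU N)) := by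
        rw [hτ₀]; exact h₁.2
      have hc := ContinuousWithinAt.comp (x := ((V, z₀) : GaugeField P n (SU N) × GaugeField P 0 (SU N)))
        (f := fun p : GaugeField P n (SU N) × GaugeField P 0 (SU N) =>
          ((p.1, extend (iterCentralBond n) (fun c => p.2 (iterCentralBond n c) * ((z₀ (iterCentralBond n c))⁻¹ * ϑ c z₀ (V c))) p.2) :
            GaugeField P n (SU N) × GaugeField P 0 (SU N)))
        h₁' hτc.continuousWithinAt hτQ
      exact hc.congr (fun p _ => (hJbl p.1 p.2 (fun c => p.2 (iterCentralBond n c) * ((z₀ (iterCentralBond n c))⁻¹ * ϑ c z₀ (V c)))).symm) (hJbl V z₀ (fun c => z₀ (iterCentralBond n c) * ((z₀ (iterCentralBond n c))⁻¹ * ϑ c z₀ (V c)))).symm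
  case charted =>
    refine ⟨fun b hb => extend_apply' _ _ _ fun ⟨c, hc⟩ => hb c hc, fun c => ?_⟩
    dsimp only
    rw [hβ.extend_apply, chainWindow_extend α hn]
    exact hmemW c z _ (hV c)
  case recog =>
    have hVc : ∀ c, V c = chainMap (expMeanLogSU (n := Fin N)) n z c (g c) := fun c => by
      have hu : update (extend (iterCentralBond n) g z) (iterCentralBond n c) (g c) = extend (iterCentralBond n) g z := by
        rw [Function.update_eq_self_iff]
        exact (hβ.extend_apply g z c).symm
      rw [hVg c, ← chainMap_extend (expMeanLogSU (n := Fin N)) hn g z c]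
      simp only [chainMap, hu]
    have hlive : ∀ c, V c ∈ T c z := fun c => by
      rw [hTeq, hVc c]
      exact mem_image_of_mem _ (hg c)
    refine ⟨?_, ?_⟩
    · have hVs : (V, z) ∈ {p : GaugeField P n (SU N) × GaugeField P 0 (SU N) | ∀ c, p.1 c ∈ T c p.2} := hlive
      show {p : GaugeField P n (SU N) × GaugeField P 0 (SU N) | ∀ c, p.1 c ∈ T c p.2}.indicator (fun p => ∏ c, jd c p.2 (p.1 c)) (V, z) ≠ 0
      rw [Set.indicator_of_mem hVs]
      exact Finset.prod_ne_zero_iff.2 fun c _ => hj0 c z _ (hlive c)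
    · have hfun : (fun c => ϑ c z (V c)) = g := funext fun c => by rw [hVc c]; exact hleft c z (g c) (hg c)
      show extend (iterCentralBond n) (fun c => ϑ c z (V c)) z = extend (iterCentralBond n) g z
      rw [hfun]
  case bdd =>
    dsimp only
    by_cases hp : p ∈ {p : GaugeField P n (SU N) × GaugeField P 0 (SU N) | ∀ c, p.1 c ∈ T c p.2}
    · rw [Set.indicator_of_mem hp]
      calc j₀ ^ (n * Fintype.card (PBond P n)) * ∏ c, jd c p.2 (p.1 c) = ∏ c, j₀ ^ n * jd c p.2 (p.1 c) := by
            rw [Finset.prod_mul_distrib, Finset.prod_const, Finset.card_univ, ← pow_mul]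
        _ ≤ ∏ _c : PBond P n, (1 : ℝ≥0) := Finset.prod_le_prod' fun c _ => hjlb c p.2 _ (hp c)
        _ = 1 := Finset.prod_const_one
    · rw [Set.indicator_of_notMem hp, mul_zero]
      exact zero_le_one
  · exact T4TriangularFibredChart.pi_restrict_preimage_inter_eq_map_prod_withDensity (fun c U => chainWindow α n U c) T ϑ jd
      (HaarData.haar : Measure (SU N)) (HaarData.haar : Measure (SU N)) hA hβ hAm (measurableSet_chainWindow₂ α n) hTm hθm hjm
      (fun c U g => chainWindow_extend α hn g U c) hright' hlaw hU₀
  · -- `Jac ≠ 0 ↔ all coordinates in the windows`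
    dsimp only
    constructor
    · intro h
      by_contra hV
      have hVs : (V, z) ∉ {p : GaugeField P n (SU N) × GaugeField P 0 (SU N) | ∀ c, p.1 c ∈ T c p.2} := hV
      exact h (Set.indicator_of_notMem hVs _)
    · intro hV
      have hVs : (V, z) ∈ {p : GaugeField P n (SU N) × GaugeField P 0 (SU N) | ∀ c, p.1 c ∈ T c p.2} := hV
      rw [Set.indicator_of_mem hVs]
      exact Finset.prod_ne_zero_iff.2 fun c _ => hj0 c z _ (hV c)
  · -- continuity at an all-interior coarse point
    have hθat : ∀ c, ContinuousAt (fun V : GaugeField P n (SU N) => ϑ c z (V c)) V₀ := fun c =>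
      ContinuousAt.comp (f := fun V : GaugeField P n (SU N) => V c) (x := V₀)
        ((hθc c z).continuousAt (mem_interior_iff_mem_nhds.1 (hint c))) (continuous_apply c).continuousAt
    refine ⟨continuousAt_pi.2 fun b => ?_, ?_⟩
    · by_cases hb : ∃ c, iterCentralBond n c = b
      · obtain ⟨c, rfl⟩ := hb
        have h1 : (fun V : GaugeField P n (SU N) => extend (iterCentralBond n) (fun c => ϑ c z (V c)) z (iterCentralBond n c)) =
            fun V => ϑ c z (V c) := funext fun V => hβ.extend_apply _ _ _
        rw [h1]
        exact hθat c
      · have h1 : (fun V : GaugeField P n (SU N) => extend (iterCentralBond n) (fun c => ϑ c z (V c)) z b) = fun _ => z b :=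
          funext fun V => extend_apply' _ _ _ hb
        rw [h1]
        exact continuousAt_const
    · have hev : ∀ᶠ V in 𝓝 V₀, ∀ c, V c ∈ T c z :=
        Filter.eventually_all.2 fun c => (continuous_apply c).continuousAt.preimage_mem_nhds (mem_interior_iff_mem_nhds.1 (hint c))
      have hprod : ContinuousOn (fun V : GaugeField P n (SU N) => ∏ c, jd c z (V c)) {V | ∀ c, V c ∈ T c z} :=
        continuousOn_finsetProd _ fun c _ => (hjc c z).comp (continuous_apply c).continuousOn fun V hV => hV c
      have hat : ContinuousAt (fun V : GaugeField P n (SU N) => ∏ c, jd c z (V c)) V₀ :=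
        hprod.continuousAt (Filter.eventually_all.2 fun c =>
          (continuous_apply c).continuousAt.preimage_mem_nhds (mem_interior_iff_mem_nhds.1 (hint c)))
      refine hat.congr ?_
      filter_upwards [hev] with V hV
      have hVs : (V, z) ∈ {p : GaugeField P n (SU N) × GaugeField P 0 (SU N) | ∀ c, p.1 c ∈ T c p.2} := hV
      exact (Set.indicator_of_mem hVs (fun p : GaugeField P n (SU N) × GaugeField P 0 (SU N) => ∏ c, jd c p.2 (p.1 c))).symm
  · -- death near a coarse point with a coordinate outside the closure of its window
    obtain ⟨c, hc⟩ := hout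
    have hev : ∀ᶠ V in 𝓝 V₀, V c ∉ closure (T c z) :=
      (continuous_apply c).continuousAt.preimage_mem_nhds (isClosed_closure.isOpen_compl.mem_nhds hc)
    filter_upwards [hev] with V hV
    have hVs : (V, z) ∉ {p : GaugeField P n (SU N) × GaugeField P 0 (SU N) | ∀ c, p.1 c ∈ T c p.2} :=
      fun h => hV (subset_closure ((show ∀ c, V c ∈ T c z from h) c))
    exact Set.indicator_of_notMem hVs _


end Summit.QuantumFields.YangMills.Theorems.FluctuationComparisonRegPrIntLS2BetaChartContBlindFibredChart

end
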